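import Literature.NumberTheory.EllipticCurves.AnticyclotomicSignedSelmer
import Literature.NumberTheory.EllipticCurves.Castella2018.AnticyclotomicSelmerDualModuleFinite
import HarnessLib

/-!
# The nine anticyclotomic signed Selmer duals `X^{𝓛,Σ}` are finitely generated `Λ^ac`-modules (proved)

`Proofs`-style sequel of `Literature/NumberTheory/EllipticCurves/AnticyclotomicSignedSelmer.lean`
(utd-ty1 g0, p600108; Castella–Wan Def. 5.1: `X^{𝓛,Σ} = Hom(Sel^{𝓛,Σ}(K_∞, E[p^∞]), ℚ/ℤ)`,
`𝓛_v ∈ {rel, ±, str}` above `p`, strict away from `p` outside `Σ`, with the CONSTRUCTED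
`Λ^ac = ℤ_p⟦T⟧`-structure `AcSigned.X.moduleOfGen hγ`, `T = γ − 1`). THEOREMS ONLY (no definition, no
named fact, no `sorry`): for EVERY elliptic curve over a number field, EVERY `ℤ_p`-extension `κ` with
topological generator `γ`, EVERY assignment `𝓛` and every FINITE `Σ`,

* §1 `X.isDualPair` — `(X^{𝓛,Σ}, Sel^{𝓛,Σ})` is a Pontryagin dual pair for `ψ = conj_γ − 1` in the
  sense of the tree's `IwasawaDual.IsDualPair` (identity `toDual`; `T` acts as `ψ`, constants through
  `ℤ_p → ℤ/p^k`, `(p, ψ)` locally nilpotent — the carrier file's `X.X_smul_apply`, `X.C_smul_apply`,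
  `isLocNil_conjSelmer_sub_one`), verbatim the shape of `Castella2018.AcSelmer.XAc.isDualPair`;
* §2 `finite_setOf_selmer_pTorsion_conjH1_eq` — **`Sel^{𝓛,Σ}(K_∞, E[p^∞])[𝔪] = {s | p s = 0, conj_γ s = s}`
  is finite**: the assembly of `Castella2018.AcSelmer.finite_setOf_selmerAc_pTorsion_conjH1_eq` run
  verbatim — lift to `H¹(K_∞, E[p])` (`exists_torsionToPrimaryH1Sub_eq`), unramified outside
  `S' = {bad} ∪ {v ∣ p} ∪ Σ` by (B′) `resOfLe_torsion_eq_zero_of_forall_conjH1_mem_awayKer` — which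
  reads ONLY the away-from-`p` conditions `AcSigned.awayConditions` shared by all nine groups, so the
  local condition types `𝓛` above `p` play no role —, finiteness of `γ`-invariant unramified classes
  (`finite_setOf_conjH1_eq_of_unramified_of`, Silverman X.4.3) and of the kernel of
  `H¹(K_∞, E[p]) → H¹(K_∞, E[p^∞])` (`finite_ker_torsionToPrimaryH1Sub`); `ℤ_p`-extensions are
  unramified outside `p` (`ZpExtension.inertia_le_kerSubgroup_holds`);
* §3 **`X.module_finite` — `X^{𝓛,Σ}` is a finitely generated `Λ^ac`-module** (Nakayama for dual
  pairs, `IwasawaDual.IsDualPair.module_finite`, Lang Ch. 5 §1); hence the carrier file's predicates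
  `X.HasRank hγ r` / `X.IsFGTorsion hγ` reduce to their `finrank` / `IsTorsion` conjuncts
  (`hasRank_iff_finrank_eq`, `isFGTorsion_iff_isTorsion`).

This is the standing "finitely generated `Λ^ac`-module" hypothesis of every rank / characteristic-ideal
statement in Castella–Wan §§4–6 and App. A (Conj. 4.8, Lemma 6.7, Thm. 6.8, Thm. A.5: "there is a
finitely generated `Λ^ac`-module `M` such that …"), Hatley–Lei–Vigni §3 and B.-D. Kim 2013 §3, here a
THEOREM about the constructed modules for every `p` (in particular `p = 3`) — banking for the `⊇`-port
of the BSD summit's crux `TwinSplitIMCAtThreeGoodSSApZero` (stmt-BirchSwinnertonDyer-23594; width seat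
bsd-wall-utd-p2-w2). Nothing about ranks, torsion-ness or characteristic ideals is claimed. BSD is not
advanced by this file.

References: [CastellaWan2023] F. Castella, X. Wan, Math. Ann. 389 (2024), §4.2, Def. 5.1, Lemma 6.7,
Thm. A.5; [GreenbergLNM1716] R. Greenberg, LNM 1716 (1999), §1 p. 60 ("`X/𝔪X` is finite … By a
version of Nakayama's Lemma … finitely generated"); [Lang1990] S. Lang, *Cyclotomic Fields I and II*,
Ch. 5 §1; [SilvermanAEC2009] X.§4 Lemma 4.3, Cor. 4.4; [Washington1997] Prop. 13.2;
[Castella2018] §2.1 ("easily shown to be a finitely generated `Λ`-module").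
-/

open CategoryTheory Literature.NumberTheory.EllipticCurves Literature.NumberTheory.GaloisRepresentations

universe u

noncomputable section

namespace Literature.NumberTheory.EllipticCurves.AcSigned

open scoped Classical AddSubgroup
open NumberField IsDedekindDomain Field
open _root_.WeierstrassCurve
open Literature.NumberTheory.EllipticCurves.GreenbergSelmer
open Literature.NumberTheory.EllipticCurves.Castella2018.AcSelmer

variable {K : Type u} [Field K] [NumberField K] (W : WeierstrassCurve K) (p : ℕ) [Fact p.Prime]
  (κ : ZpExtension K p) (S : Set (HeightOneSpectrum (𝓞 K))) (L : HeightOneSpectrum (𝓞 K) → PCond)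

/-! ## §1 `(X^{𝓛,Σ}, Sel^{𝓛,Σ})` is a Pontryagin dual pair for `ψ = conj_γ − 1` -/

/-- **`(X^{𝓛,Σ}, Sel^{𝓛,Σ}(K_∞, E[p^∞]))` is a dual pair** in the sense of `IwasawaDual.IsDualPair`
for `ψ = conj_γ − 1` and the `Λ^ac`-structure `X.moduleOfGen hγ`: `toDual` is the identity of
`X^{𝓛,Σ} = Hom(Sel^{𝓛,Σ}, ℚ/ℤ)`, `T` acts as `ψ` (`X.X_smul_apply`), constants through `ℤ_p → ℤ/p^k`
(`X.C_smul_apply`), `(p, ψ)` is locally nilpotent (`isLocNil_conjSelmer_sub_one`). Same shape as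
`Castella2018.AcSelmer.XAc.isDualPair`. [cite: CastellaWan2023, §4.2 (MS p. 22), "`X_± = Hom_{ℤ_p}(Sel_±(K, 𝐀^ac), ℚ_p/ℤ_p)`"]
[cite: GreenbergLNM1716, §1 p. 60 (after Conj. 1.3)] -/
theorem X.isDualPair {γ : absoluteGaloisGroup K} (hγ : κ.IsTopGenerator γ) :
    letI := X.moduleOfGen W p κ S L hγ
    IwasawaDual.IsDualPair p (conjSelmer W p κ S L γ - 1) (AddMonoidHom.id (X W p κ S L)) := by
  letI := X.moduleOfGen W p κ S L hγ
  exact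
    { bijective := Function.bijective_id
      T_smul := fun x s ↦ by
        show ((PowerSeries.X : IwasawaAlgebra p) • x) s = x ((conjSelmer W p κ S L γ - 1) s)
        rw [X.X_smul_apply, IwasawaDual.End_sub_apply, AddMonoid.End.one_apply, map_sub]
      C_smul := fun c x s k hk ↦ by
        show ((PowerSeries.C c : IwasawaAlgebra p) • x) s = (PadicInt.toZModPow k c).val • x s
        exact X.C_smul_apply W p κ S L hγ c x hk
      locNil := isLocNil_conjSelmer_sub_one W p κ S L hγ }

/-! ## §2 `Sel^{𝓛,Σ}(K_∞, E[p^∞])[𝔪]` is finite for finite `Σ` -/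

variable {W p S L}

/-- **`Sel^{𝓛,Σ}(K_∞, E[p^∞])[𝔪]` is finite**: for an elliptic curve over a number field, ANY prime `p`,
ANY `ℤ_p`-extension `κ` with topological generator `γ`, ANY assignment `𝓛` of condition types above `p`
and any FINITE `Σ`, the set of `s ∈ Sel^{𝓛,Σ}(K_∞, E[p^∞])` with `p s = 0` and `conj_γ s = s` is finite
— the Pontryagin dual of "`X^{𝓛,Σ}/𝔪 X^{𝓛,Σ}` is finite" (Greenberg, LNM 1716, §1 p. 60). The assembly of
`Castella2018.AcSelmer.finite_setOf_selmerAc_pTorsion_conjH1_eq` VERBATIM: only the away-from-`p`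
conditions (`awayConditions`: every conjugate trivial at the places above good `v ∉ Σ`, `v ∤ p`) are
read, through (B′) `resOfLe_torsion_eq_zero_of_forall_conjH1_mem_awayKer`; the condition types above
`p` are not used. [cite: GreenbergLNM1716, §1 p. 60 (after Conj. 1.3)] [cite: CastellaWan2023, Def. 5.1 (MS p. 23)]
[cite: SilvermanAEC2009, X.4 Lemma 4.3 and Cor. 4.4] -/
theorem finite_setOf_selmer_pTorsion_conjH1_eq [W.IsElliptic] (hS : S.Finite)
    {γ : absoluteGaloisGroup K} (hγ : κ.IsTopGenerator γ) :
    Set.Finite {s : selmer W p κ S L |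
      p • s = 0 ∧ W.conjH1 p κ.kerSubgroup γ (s : W.subgroupH1 p κ.kerSubgroup) = s} := by
  classical
  have hp := (Fact.out : p.Prime)
  have hIκ : ∀ ⦃v : HeightOneSpectrum (𝓞 K)⦄, (p : 𝓞 K) ∉ v.asIdeal →
      ∀ ⦃𝔓 : Ideal (absIntegers (𝓞 K) K)⦄, 𝔓 ∈ v.primesAbove →
        𝔓.inertia (absoluteGaloisGroup K) ≤ κ.kerSubgroup :=
    fun _ hv _ h𝔓 ↦ ZpExtension.inertia_le_kerSubgroup_holds K p κ hv h𝔓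
  -- notation
  let ιN := W.torsionToPrimaryH1Sub p κ.kerSubgroup
  -- the finite exceptional set of places
  let S' : Set (HeightOneSpectrum (𝓞 K)) :=
    (W.badPlaces (𝓞 K) ∪ {v | ((p : ℤ) : 𝓞 K) ∈ v.asIdeal}) ∪ S
  have hbad : (W.badPlaces (𝓞 K)).Finite := W.finite_badPlaces_holds (𝓞 K)
  have hS' : S'.Finite := (hbad.union
    (finite_setOf_intCast_mem_asIdeal (by exact_mod_cast hp.ne_zero))).union hS
  have hSp : ∀ v : HeightOneSpectrum (𝓞 K), (p : 𝓞 K) ∈ v.asIdeal → v ∈ S' := fun v hv ↦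
    Or.inl (Or.inr (by simpa using hv))
  -- unramified predicate on `H¹(N, E[p])`
  let Unr : Literature.NumberTheory.EllipticCurves.subgroupH1 κ.kerSubgroup (geomTorsion W (p : ℤ)) →
      Prop := fun x ↦
    ∀ v : HeightOneSpectrum (𝓞 K), v ∉ S' → ∀ 𝔓 ∈ v.primesAbove,
      ∀ hle : 𝔓.inertia (absoluteGaloisGroup K) ≤ κ.kerSubgroup,
        Literature.NumberTheory.EllipticCurves.resOfLe (geomTorsion W (p : ℤ)) hle x = 0
  have hUnr_sub : ∀ x y, Unr x → Unr y → Unr (x - y) := fun x y hx hy v hv 𝔓 h𝔓 hle ↦ by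
    rw [map_sub, hx v hv 𝔓 h𝔓 hle, hy v hv 𝔓 h𝔓 hle, sub_zero]
  -- (D) the `γ`-invariant unramified classes are finite
  haveI : Finite (geomTorsion W (p : ℤ)) :=
    finite_torsionPoints_holds W (AlgebraicClosure K) (by exact_mod_cast hp.ne_zero)
  haveI : ContinuousSMul (absoluteGaloisGroup K) (geomTorsion W (p : ℤ)) :=
    continuousSMul_geomTorsion W (isOpen_stabilizer_point_holds W) _
  have hpM : ∀ m : geomTorsion W (p : ℤ), p • m = 0 := fun m ↦
    Subtype.ext (by rw [AddSubgroupClass.coe_nsmul, ZeroMemClass.coe_zero]; exact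
      AddSubgroup.torsionBy.nsmul_iff.mp m.2)
  have hA₀ := finite_setOf_conjH1_eq_of_unramified_of κ (M := geomTorsion W (p : ℤ))
    hγ hpM (finite_h1Unramified_holds K) hIκ hS' hSp
  -- (A) the kernel of `ιN` is finite
  have hF₀ := W.finite_ker_torsionToPrimaryH1Sub p (H := κ.kerSubgroup)
    W.zsmul_geomPoints_surjective_holds
  -- the lifts: `{y | ιN y ∈ Sel, conj_γ (ιN y) = ιN y}` is finite
  have hL : Set.Finite {y : Literature.NumberTheory.EllipticCurves.subgroupH1 κ.kerSubgroup
      (geomTorsion W (p : ℤ)) |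
      ιN y ∈ selmer W p κ S L ∧ W.conjH1 p κ.kerSubgroup γ (ιN y) = ιN y} := by
    -- `⊆ {y | Unr y ∧ conj_γ y - y ∈ ker ιN}`
    have hsub : {y : Literature.NumberTheory.EllipticCurves.subgroupH1 κ.kerSubgroup
        (geomTorsion W (p : ℤ)) |
        ιN y ∈ selmer W p κ S L ∧ W.conjH1 p κ.kerSubgroup γ (ιN y) = ιN y} ⊆
        ⋃ f ∈ (ιN.ker : Set _), {y | Unr y ∧
          Literature.NumberTheory.EllipticCurves.conjH1 κ.kerSubgroup (geomTorsion W (p : ℤ)) γ y -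
            y = f} := by
      rintro y ⟨hy1, hy2⟩
      simp only [Set.mem_iUnion, Set.mem_setOf_eq, SetLike.mem_coe, exists_prop]
      refine ⟨_, ?_, ?_, rfl⟩
      · rw [AddMonoidHom.mem_ker, map_sub, ← conjH1_torsionToPrimaryH1Sub, hy2, sub_self]
      · intro v hv 𝔓 h𝔓 hle
        have hv' : v ∉ W.badPlaces (𝓞 K) := fun h ↦ hv (Or.inl (Or.inl h))
        have hpv : (p : 𝓞 K) ∉ v.asIdeal := fun h ↦ hv (hSp v h)
        have hpv₀ : ((p : ℕ) : 𝓞 K) ∉ v.asIdeal := hpv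
        have hvS : v ∉ S := fun h ↦ hv (Or.inr h)
        have haway := ((mem_awayConditions_iff W p κ (ιN y)).mp ((mem_selmer_iff (ιN y)).mp hy1).1).1
        exact resOfLe_torsion_eq_zero_of_forall_conjH1_mem_awayKer (H := κ.kerSubgroup)
          (fun σ ↦ haway v hpv₀ hvS σ) hv' hpv h𝔓 hle
    refine (hF₀.biUnion fun f _ ↦ ?_).subset hsub
    -- each piece is empty or a translate of the finite set of (D)
    by_cases hne : {y | Unr y ∧
        Literature.NumberTheory.EllipticCurves.conjH1 κ.kerSubgroup (geomTorsion W (p : ℤ)) γ y -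
          y = f}.Nonempty
    · obtain ⟨y₀, hy₀U, hy₀⟩ := hne
      refine (hA₀.image fun a ↦ y₀ + a).subset ?_
      rintro y ⟨hyU, hy⟩
      refine ⟨y - y₀, ⟨?_, hUnr_sub y y₀ hyU hy₀U⟩, by abel⟩
      rw [map_sub, sub_eq_iff_eq_add.mp hy, sub_eq_iff_eq_add.mp hy₀]
      abel
    · rw [Set.not_nonempty_iff_eq_empty.mp hne]
      exact Set.finite_empty
  -- conclusion: the target set is the preimage under the (injective) coercion of `ιN '' L`
  refine ((hL.image ιN).preimage (Subtype.val_injective.injOn)).subset ?_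
  rintro s ⟨hs1, hs2⟩
  have hps : p • (s : W.subgroupH1 p κ.kerSubgroup) = 0 := by
    rw [← AddSubgroupClass.coe_nsmul, hs1, ZeroMemClass.coe_zero]
  obtain ⟨y, hy⟩ := W.exists_torsionToPrimaryH1Sub_eq p (H := κ.kerSubgroup)
    W.zsmul_geomPoints_surjective_holds hps
  refine ⟨y, ⟨?_, ?_⟩, hy⟩
  · show ιN y ∈ selmer W p κ S L
    rw [show ιN y = (s : W.subgroupH1 p κ.kerSubgroup) from hy]; exact s.2
  · show W.conjH1 p κ.kerSubgroup γ (ιN y) = ιN y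
    rw [show ιN y = (s : W.subgroupH1 p κ.kerSubgroup) from hy]; exact hs2

/-! ## §3 `X^{𝓛,Σ}` is a finitely generated `Λ^ac`-module -/

variable (W p S L)

/-- **Nakayama for `X^{𝓛,Σ}`**: if `Sel^{𝓛,Σ}(K_∞, E[p^∞])[𝔪]` is finite then `X^{𝓛,Σ}` is a finitely
generated `Λ^ac`-module for the structure `X.moduleOfGen hγ` (`IwasawaDual.IsDualPair.module_finite`
applied to `X.isDualPair`). [cite: Lang1990, Ch. 5 §1 (Nakayama's lemma)] [cite: GreenbergLNM1716, §1 p. 60] -/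
theorem X.module_finite_of_finite {γ : absoluteGaloisGroup K} (hγ : κ.IsTopGenerator γ)
    (hfin : Set.Finite {s : selmer W p κ S L |
      p • s = 0 ∧ W.conjH1 p κ.kerSubgroup γ (s : W.subgroupH1 p κ.kerSubgroup) = s}) :
    letI := X.moduleOfGen W p κ S L hγ
    Module.Finite (IwasawaAlgebra p) (X W p κ S L) := by
  letI := X.moduleOfGen W p κ S L hγ
  refine (X.isDualPair W p κ S L hγ).module_finite ?_
  refine hfin.subset fun s hs ↦ ?_
  obtain ⟨hs1, hs2⟩ := hs
  rw [pow_one] at hs1 hs2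
  refine ⟨hs1, ?_⟩
  rw [IwasawaDual.End_sub_apply, AddMonoid.End.one_apply, sub_eq_zero] at hs2
  have h := congrArg (fun z : selmer W p κ S L ↦ (z : W.subgroupH1 p κ.kerSubgroup)) hs2
  simpa only [coe_conjSelmer_apply] using h

/-- **`X^{𝓛,Σ}` is a finitely generated `Λ^ac = ℤ_p⟦T⟧`-module** for every elliptic curve over a number
field, every prime `p`, every `ℤ_p`-extension `κ` with topological generator `γ` (the structure
`X.moduleOfGen hγ`), every assignment `𝓛` of local condition types `rel / ± / str` above `p` and every
FINITE `Σ` — in particular for Castella–Wan's `X_± = X^{±,±}`, `X^{rel,str}`, `X^{±,str}`, `X^{rel,±}`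
(§4.2, Def. 5.1, Lemma 6.7, Thm. A.5: "a finitely generated `Λ^ac`-module") at `p = 3`.
[cite: CastellaWan2023, Def. 5.1 and Lemma 6.7 (MS pp. 23, 28)] [cite: GreenbergLNM1716, §1 p. 60 (after Conj. 1.3)]
[cite: Lang1990, Ch. 5 §1 (Nakayama's lemma)] -/
theorem X.module_finite [W.IsElliptic] (hS : S.Finite) {γ : absoluteGaloisGroup K}
    (hγ : κ.IsTopGenerator γ) :
    letI := X.moduleOfGen W p κ S L hγ
    Module.Finite (IwasawaAlgebra p) (X W p κ S L) :=
  X.module_finite_of_finite W p κ S L hγ (finite_setOf_selmer_pTorsion_conjH1_eq κ hS hγ)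

/-- The case `Σ = ∅` (Castella–Wan's `Sel^𝓛(K, 𝐀^ac)` proper, e.g. `X_± = X^{±,±}`): `X^{𝓛}` is a
finitely generated `Λ^ac`-module. [cite: CastellaWan2023, §4.2 and Def. 5.1 (MS pp. 22–23)] -/
theorem X.module_finite_empty [W.IsElliptic] {γ : absoluteGaloisGroup K} (hγ : κ.IsTopGenerator γ) :
    letI := X.moduleOfGen W p κ ∅ L hγ
    Module.Finite (IwasawaAlgebra p) (X W p κ ∅ L) :=
  X.module_finite W p κ ∅ L Set.finite_empty hγ

/-- **`X.HasRank hγ r` is the `finrank` statement alone** (its `Module.Finite` conjunct is a theorem,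
finite `Σ`). [cite: CastellaWan2023, Conj. 4.8 (2) and Thm. A.5 (MS pp. 22, 34)] -/
theorem X.hasRank_iff_finrank_eq [W.IsElliptic] (hS : S.Finite) {γ : absoluteGaloisGroup K}
    (hγ : κ.IsTopGenerator γ) (r : ℕ) :
    X.HasRank W p κ S L hγ r ↔
      (letI := X.moduleOfGen W p κ S L hγ; Module.finrank (IwasawaAlgebra p) (X W p κ S L) = r) :=
  ⟨fun h ↦ h.2, fun h ↦ ⟨X.module_finite W p κ S L hS hγ, h⟩⟩

/-- **`X.IsFGTorsion hγ` is the `IsTorsion` statement alone** (its `Module.Finite` conjunct is a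
theorem, finite `Σ`). [cite: CastellaWan2023, Conj. 5.2 and Thm. 6.8 (ii) (MS pp. 23, 30)] -/
theorem X.isFGTorsion_iff_isTorsion [W.IsElliptic] (hS : S.Finite) {γ : absoluteGaloisGroup K}
    (hγ : κ.IsTopGenerator γ) :
    X.IsFGTorsion W p κ S L hγ ↔
      (letI := X.moduleOfGen W p κ S L hγ; Module.IsTorsion (IwasawaAlgebra p) (X W p κ S L)) :=
  ⟨fun h ↦ h.2, fun h ↦ ⟨X.module_finite W p κ S L hS hγ, h⟩⟩

end Literature.NumberTheory.EllipticCurves.AcSigned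

end
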